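import Mathlib
import Literature.Analysis.FluidPDE.VorticityEquation
import Literature.Analysis.FluidPDE.KNSSProp41OfLocal
import Literature.Analysis.FluidPDE.KNSSThm52Integrand
import Literature.Analysis.FluidPDE.KNSSLiouvillePlanarHolds
import Literature.Analysis.FluidPDE.ClassicalSolutionCalculus
import Literature.Analysis.FluidPDE.ConstantinDirectionDissipationProofs
import Literature.Analysis.PDE.SobolevSupBound
import Summits.NavierStokesRegularity.NavierStokesRegularity.Theorems.RootDecompLitSliceDarkBallSpreadsFlatnessInduction
import HarnessLib

/-!
# Route RootDecompLitSlice — brick B3 (Navier–Stokes instantiation) of the aside D₁ `DarkBallSpreads`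
# (stmt-NavierStokesRegularity-29566): THE VORTICITY VANISHES TO INFINITE ORDER AT THE TERMINAL TIME
# WHERE ITS TERMINAL LIMIT VANISHES

For a classical solution `(u, p)` of the unforced Navier–Stokes system on `[0, T) × ℝ³` (`ν > 0`), a backward cylinder
`(T − R², T) × B_R(x₁)` (`R² < T`) on which every spatial derivative of `u` is bounded (brick B1,
`regularPoint_iteratedFDeriv_bounds`), and a set `s ⊆ B_R(x₁)` at whose points every spatial derivative of the vorticity
`ω = curl u` tends to `0` as `t → T⁻` (the dark-ball input read through the writer's terminal-limit tower B1′ and the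
slice identification B2), the vorticity is FLAT at the terminal time on `s`, uniformly:
`‖Dⁿₓ ω(t, x)‖ ≤ C_{n,k} (T − t)^k` for all `n k`, `x ∈ s`, `t ∈ (T − R², T)` (`vorticity_flat_of_tendsto_zero`).

Mechanism (the census's B3 plan, bus L1177/L1193): the abstract induction `norm_le_mul_pow_of_deriv_le_sum` (brick
B3 core) fed with `g n x t = Dⁿₓω(t, x)`:
* `∂ₜDⁿₓω = Dⁿₓ∂ₜω` for the jointly smooth vorticity (`IsSmoothSpaceTimeOn.hasDerivAt_iteratedFDeriv_slice`);
* the vorticity equation `∂ₜω = νΔω − (u·∇)ω + (ω·∇)u` (`IsClassicalNSSolutionOn.vorticity_eq`), differentiated `n`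
  times in space with pointwise Leibniz bounds (`norm_iteratedFDeriv_clm_apply`, `norm_iteratedFDeriv_laplacian_le`):
  `‖Dⁿₓ∂ₜω‖ ≤ A_n Σ_{j ≤ n+2} ‖Dʲₓω‖` with `A_n` from the bounds on `Dʲu` — NO pressure, NO higher time derivatives;
* `‖Dⁿₓω‖ ≤ ‖curl‖·K_{n+1}` (`norm_iteratedFDeriv_curl_le`).

HONEST FRAMING: bookkeeping about a HYPOTHETICAL singular time; closes no item (D₁ still needs the ESS application
and the assembly); nothing here bears on NS regularity (rung 0).
Lands `--supports stmt-NavierStokesRegularity-29566` (census instrument decomp-ns-census-1 g28).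
-/

noncomputable section

open Set Filter Topology Metric Function
open scoped NNReal ContDiff Laplacian
open Literature.Analysis Literature.Analysis.FluidPDE

-- the summit and its single sub-problem share the name (CONVENTIONS §1), as in every Theorems file
set_option linter.dupNamespace false

namespace Summit.NavierStokesRegularity.NavierStokesRegularity.Theorems

/-- A weighted sum of shifted terms is bounded by (sum of weights) × (full sum): if `0 ≤ c i`, `0 ≤ a j` and every
index `σ i` (`i < m`) lies below `N`, then `Σ_{i<m} c i · a (σ i) ≤ (Σ_{i<m} c i) · Σ_{j<N} a j`. [folklore] -/
theorem sum_mul_shift_le {m N : ℕ} (c a : ℕ → ℝ) (σ : ℕ → ℕ) (hc : ∀ i, 0 ≤ c i) (ha : ∀ j, 0 ≤ a j)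
    (hσ : ∀ i < m, σ i < N) :
    ∑ i ∈ Finset.range m, c i * a (σ i) ≤ (∑ i ∈ Finset.range m, c i) * ∑ j ∈ Finset.range N, a j := by
  rw [Finset.sum_mul]
  refine Finset.sum_le_sum fun i hi => mul_le_mul_of_nonneg_left ?_ (hc i)
  exact Finset.single_le_sum (f := a) (fun j _ => ha j) (Finset.mem_range.2 (hσ i (Finset.mem_range.1 hi)))

/-- **Leibniz bound for `Dⁿ((U·∇)W)`** with bounds on `DʲU`, `j ≤ n`: `≤ (Σ C(n,i) K(n−i)) · Σ_{j<n+3} ‖DʲW‖`. [folklore] -/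
theorem norm_iteratedFDeriv_convect_le_of_bounds {U W : EuclideanSpace ℝ (Fin 3) → EuclideanSpace ℝ (Fin 3)}
    (hU : ContDiff ℝ ∞ U) (hW : ContDiff ℝ ∞ W) (n : ℕ) (K : ℕ → ℝ) (hK0 : ∀ j, 0 ≤ K j)
    (x : EuclideanSpace ℝ (Fin 3)) (hK : ∀ j ≤ n + 1, ‖iteratedFDeriv ℝ j U x‖ ≤ K j) :
    ‖iteratedFDeriv ℝ n (fun y => convect U W y) x‖ ≤
      (∑ i ∈ Finset.range (n + 1), (n.choose i : ℝ) * K (n - i)) *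
        ∑ j ∈ Finset.range (n + 3), ‖iteratedFDeriv ℝ j W x‖ := by
  have hDW : ContDiff ℝ ∞ (fderiv ℝ W) := hW.fderiv_right (m := ∞) (by exact_mod_cast le_rfl)
  have h := norm_iteratedFDeriv_clm_apply (f := fderiv ℝ W) (g := U) (n := n) hDW hU x
    (by exact_mod_cast le_top)
  have hcv : (fun y => convect U W y) = fun y => (fderiv ℝ W y) (U y) := rfl
  rw [hcv]
  refine h.trans ?_
  calc ∑ i ∈ Finset.range (n + 1), (n.choose i : ℝ) * ‖iteratedFDeriv ℝ i (fderiv ℝ W) x‖ *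
          ‖iteratedFDeriv ℝ (n - i) U x‖
      ≤ ∑ i ∈ Finset.range (n + 1), ((n.choose i : ℝ) * K (n - i)) * ‖iteratedFDeriv ℝ (i + 1) W x‖ := by
        refine Finset.sum_le_sum fun i hi => ?_
        have hin : i ≤ n := Nat.lt_succ_iff.1 (Finset.mem_range.1 hi)
        rw [norm_iteratedFDeriv_fderiv]
        have h1 : ‖iteratedFDeriv ℝ (n - i) U x‖ ≤ K (n - i) := hK (n - i) (by omega)
        have h2 : 0 ≤ (n.choose i : ℝ) * ‖iteratedFDeriv ℝ (i + 1) W x‖ := by positivity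
        nlinarith [h1, h2, norm_nonneg (iteratedFDeriv ℝ (i + 1) W x), Nat.cast_nonneg (α := ℝ) (n.choose i)]
    _ ≤ (∑ i ∈ Finset.range (n + 1), (n.choose i : ℝ) * K (n - i)) *
          ∑ j ∈ Finset.range (n + 3), ‖iteratedFDeriv ℝ j W x‖ :=
        sum_mul_shift_le (fun i => (n.choose i : ℝ) * K (n - i)) (fun j => ‖iteratedFDeriv ℝ j W x‖)
          (fun i => i + 1) (fun i => mul_nonneg (Nat.cast_nonneg _) (hK0 _)) (fun _ => norm_nonneg _)
          (fun i hi => by omega)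

/-- **Leibniz bound for `Dⁿ((W·∇)U)`** with bounds on `DʲU`, `j ≤ n + 1`: `≤ (Σ C(n,i) K(i+1)) · Σ_{j<n+3} ‖DʲW‖`. [folklore] -/
theorem norm_iteratedFDeriv_convect_le_of_bounds' {U W : EuclideanSpace ℝ (Fin 3) → EuclideanSpace ℝ (Fin 3)}
    (hU : ContDiff ℝ ∞ U) (hW : ContDiff ℝ ∞ W) (n : ℕ) (K : ℕ → ℝ) (hK0 : ∀ j, 0 ≤ K j)
    (x : EuclideanSpace ℝ (Fin 3)) (hK : ∀ j ≤ n + 1, ‖iteratedFDeriv ℝ j U x‖ ≤ K j) :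
    ‖iteratedFDeriv ℝ n (fun y => convect W U y) x‖ ≤
      (∑ i ∈ Finset.range (n + 1), (n.choose i : ℝ) * K (i + 1)) *
        ∑ j ∈ Finset.range (n + 3), ‖iteratedFDeriv ℝ j W x‖ := by
  have hDU : ContDiff ℝ ∞ (fderiv ℝ U) := hU.fderiv_right (m := ∞) (by exact_mod_cast le_rfl)
  have h := norm_iteratedFDeriv_clm_apply (f := fderiv ℝ U) (g := W) (n := n) hDU hW x
    (by exact_mod_cast le_top)
  have hcv : (fun y => convect W U y) = fun y => (fderiv ℝ U y) (W y) := rfl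
  rw [hcv]
  refine h.trans ?_
  calc ∑ i ∈ Finset.range (n + 1), (n.choose i : ℝ) * ‖iteratedFDeriv ℝ i (fderiv ℝ U) x‖ *
          ‖iteratedFDeriv ℝ (n - i) W x‖
      ≤ ∑ i ∈ Finset.range (n + 1), ((n.choose i : ℝ) * K (i + 1)) * ‖iteratedFDeriv ℝ (n - i) W x‖ := by
        refine Finset.sum_le_sum fun i hi => ?_
        rw [norm_iteratedFDeriv_fderiv]
        have h1 : ‖iteratedFDeriv ℝ (i + 1) U x‖ ≤ K (i + 1) := hK (i + 1) (by
          have := Finset.mem_range.1 hi; omega)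
        exact mul_le_mul_of_nonneg_right (mul_le_mul_of_nonneg_left h1 (Nat.cast_nonneg _)) (norm_nonneg _)
    _ ≤ (∑ i ∈ Finset.range (n + 1), (n.choose i : ℝ) * K (i + 1)) *
          ∑ j ∈ Finset.range (n + 3), ‖iteratedFDeriv ℝ j W x‖ :=
        sum_mul_shift_le (fun i => (n.choose i : ℝ) * K (i + 1)) (fun j => ‖iteratedFDeriv ℝ j W x‖)
          (fun i => n - i) (fun i => mul_nonneg (Nat.cast_nonneg _) (hK0 _)) (fun _ => norm_nonneg _)
          (fun i hi => by omega)

/-- **Bound for `Dⁿ(ΔW)`**: `≤ 3 Σ_{j<n+3} ‖DʲW‖` (`ℝ³`). [folklore] -/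
theorem norm_iteratedFDeriv_laplacian_le_range_sum {W : EuclideanSpace ℝ (Fin 3) → EuclideanSpace ℝ (Fin 3)}
    (hW : ContDiff ℝ ∞ W) (n : ℕ) (x : EuclideanSpace ℝ (Fin 3)) :
    ‖iteratedFDeriv ℝ n (fun y => (Δ W) y) x‖ ≤ 3 * ∑ j ∈ Finset.range (n + 3), ‖iteratedFDeriv ℝ j W x‖ := by
  have h := norm_iteratedFDeriv_laplacian_le hW n x
  rw [finrank_euclideanSpace_fin] at h
  have hterm : ‖iteratedFDeriv ℝ (n + 2) W x‖ ≤ ∑ j ∈ Finset.range (n + 3), ‖iteratedFDeriv ℝ j W x‖ :=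
    Finset.single_le_sum (f := fun j => ‖iteratedFDeriv ℝ j W x‖) (fun _ _ => norm_nonneg _)
      (Finset.mem_range.2 (by omega))
  calc ‖iteratedFDeriv ℝ n (fun y => (Δ W) y) x‖ = ‖iteratedFDeriv ℝ n (Δ W) x‖ := rfl
    _ ≤ ((3 : ℕ) : ℝ) * ‖iteratedFDeriv ℝ (n + 2) W x‖ := h
    _ ≤ 3 * ∑ j ∈ Finset.range (n + 3), ‖iteratedFDeriv ℝ j W x‖ := by
        push_cast; exact mul_le_mul_of_nonneg_left hterm (by norm_num)

/-- **Pointwise Leibniz bound for the spatial derivatives of the vorticity right-hand side.** For `C^∞` fields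
`U, W : ℝ³ → ℝ³` with `‖DʲU(x)‖ ≤ K j` (`j ≤ n + 1`, `K ≥ 0`) at a point `x`:
`‖Dⁿ(νΔW − (U·∇)W + (W·∇)U)(x)‖ ≤ A · Σ_{j < n+3} ‖DʲW(x)‖` with
`A = 3|ν| + Σ_{i ≤ n} C(n,i) (K(n−i) + K(i+1))`. [folklore] -/
theorem norm_iteratedFDeriv_vorticityRHS_le {U W : EuclideanSpace ℝ (Fin 3) → EuclideanSpace ℝ (Fin 3)}
    (hU : ContDiff ℝ ∞ U) (hW : ContDiff ℝ ∞ W) (ν : ℝ) (n : ℕ) (K : ℕ → ℝ) (hK0 : ∀ j, 0 ≤ K j)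
    (x : EuclideanSpace ℝ (Fin 3)) (hK : ∀ j ≤ n + 1, ‖iteratedFDeriv ℝ j U x‖ ≤ K j) :
    ‖iteratedFDeriv ℝ n (fun y => ν • (Δ W) y - convect U W y + convect W U y) x‖ ≤
      (3 * |ν| + ∑ i ∈ Finset.range (n + 1), (n.choose i : ℝ) * (K (n - i) + K (i + 1))) *
        ∑ j ∈ Finset.range (n + 3), ‖iteratedFDeriv ℝ j W x‖ := by
  have hΔ : ContDiff ℝ ∞ (fun y => (Δ W) y) := Literature.Analysis.PDE.contDiff_laplacian_of_contDiff hW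
  have hDW : ContDiff ℝ ∞ (fderiv ℝ W) := hW.fderiv_right (m := ∞) (by exact_mod_cast le_rfl)
  have hDU : ContDiff ℝ ∞ (fderiv ℝ U) := hU.fderiv_right (m := ∞) (by exact_mod_cast le_rfl)
  have hc1 : ContDiff ℝ ∞ (fun y => convect U W y) := hDW.clm_apply hU
  have hc2 : ContDiff ℝ ∞ (fun y => convect W U y) := hDU.clm_apply hW
  have hνΔ : ContDiff ℝ ∞ (fun y => ν • (Δ W) y) := hΔ.const_smul ν
  have h12 : ContDiff ℝ ∞ (fun y => ν • (Δ W) y - convect U W y) := hνΔ.sub hc1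
  have hn : ((n : ℕ∞) : ℕ∞ω) ≤ ∞ := by exact_mod_cast le_top
  have e1 : iteratedFDeriv ℝ n (fun y => ν • (Δ W) y - convect U W y + convect W U y) x =
      iteratedFDeriv ℝ n (fun y => ν • (Δ W) y) x - iteratedFDeriv ℝ n (fun y => convect U W y) x
        + iteratedFDeriv ℝ n (fun y => convect W U y) x := by
    have hadd := fun_iteratedFDeriv_add_apply (𝕜 := ℝ) (f := fun y => ν • (Δ W) y - convect U W y)
      (g := fun y => convect W U y) (x := x) (i := n) (h12.contDiffAt.of_le hn) (hc2.contDiffAt.of_le hn)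
    have hsub := fun_iteratedFDeriv_sub_apply (𝕜 := ℝ) (f := fun y => ν • (Δ W) y) (g := fun y => convect U W y)
      (x := x) (i := n) (hνΔ.contDiffAt.of_le hn) (hc1.contDiffAt.of_le hn)
    rw [hadd, hsub]
  have e2 : iteratedFDeriv ℝ n (fun y => ν • (Δ W) y) x = ν • iteratedFDeriv ℝ n (fun y => (Δ W) y) x :=
    iteratedFDeriv_const_smul_apply' (f := fun y => (Δ W) y) (a := ν) (hΔ.contDiffAt.of_le hn)
  set S := ∑ j ∈ Finset.range (n + 3), ‖iteratedFDeriv ℝ j W x‖ with hS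
  have bΔ := norm_iteratedFDeriv_laplacian_le_range_sum hW n x
  have b1 := norm_iteratedFDeriv_convect_le_of_bounds hU hW n K hK0 x hK
  have b2 := norm_iteratedFDeriv_convect_le_of_bounds' hU hW n K hK0 x hK
  rw [e1, e2]
  set DΔ := iteratedFDeriv ℝ n (fun y => (Δ W) y) x with hDΔ
  set D1 := iteratedFDeriv ℝ n (fun y => convect U W y) x with hD1
  set D2 := iteratedFDeriv ℝ n (fun y => convect W U y) x with hD2
  set T1 := ∑ i ∈ Finset.range (n + 1), (n.choose i : ℝ) * K (n - i) with hT1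
  set T2 := ∑ i ∈ Finset.range (n + 1), (n.choose i : ℝ) * K (i + 1) with hT2
  have hsplit : ∑ i ∈ Finset.range (n + 1), (n.choose i : ℝ) * (K (n - i) + K (i + 1)) = T1 + T2 := by
    rw [hT1, hT2, ← Finset.sum_add_distrib]
    exact Finset.sum_congr rfl fun i _ => by ring
  have hA : ‖ν • DΔ‖ ≤ |ν| * (3 * S) := by
    rw [norm_smul, Real.norm_eq_abs]
    exact mul_le_mul_of_nonneg_left bΔ (abs_nonneg _)
  have htri : ‖ν • DΔ - D1 + D2‖ ≤ ‖ν • DΔ‖ + ‖D1‖ + ‖D2‖ := by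
    linarith [norm_add_le (ν • DΔ - D1) D2, norm_sub_le (ν • DΔ) D1]
  rw [hsplit]
  have hexp : (3 * |ν| + (T1 + T2)) * S = |ν| * (3 * S) + T1 * S + T2 * S := by ring
  rw [hexp]
  linarith [hA, htri, b1, b2]

/-- **Flatness ⟹ infinite order, dependent-type form** of the landed `norm_le_mul_pow_of_deriv_le_sum` (brick B3 core):
the value space may depend on the derivative order `n` (as `E [×n]→L F` does). Same proof. [folklore] -/
theorem norm_le_mul_pow_of_deriv_le_sum_dep {ι : Type*} {F : ℕ → Type*} [∀ n, NormedAddCommGroup (F n)]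
    [∀ n, NormedSpace ℝ (F n)] {a T : ℝ} (g g' : (n : ℕ) → ι → ℝ → F n) (A K : ℕ → ℝ)
    (hderiv : ∀ n i, ∀ t ∈ Ioo a T, HasDerivAt (g n i) (g' n i t) t)
    (hbound : ∀ n i, ∀ t ∈ Ioo a T, ‖g n i t‖ ≤ K n)
    (hstruct : ∀ n i, ∀ t ∈ Ioo a T, ‖g' n i t‖ ≤ A n * ∑ j ∈ Finset.range (n + 3), ‖g j i t‖)
    (hlim : ∀ n i, Tendsto (g n i) (𝓝[<] T) (𝓝 0)) :
    ∀ k : ℕ, ∃ C : ℕ → ℝ, (∀ n, 0 ≤ C n) ∧ ∀ n i, ∀ t ∈ Ioo a T, ‖g n i t‖ ≤ C n * (T - t) ^ k := by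
  intro k
  induction k with
  | zero =>
    refine ⟨fun n => max (K n) 0, fun n => le_max_right _ _, fun n i t ht => ?_⟩
    rw [pow_zero, mul_one]
    exact (hbound n i t ht).trans (le_max_left _ _)
  | succ k ih =>
    obtain ⟨C, hC0, hC⟩ := ih
    refine ⟨fun n => max (A n) 0 * ∑ j ∈ Finset.range (n + 3), C j, fun n => ?_, fun n i t ht => ?_⟩
    · exact mul_nonneg (le_max_right _ _) (Finset.sum_nonneg fun j _ => hC0 j)
    have hB : ∀ s ∈ Ico t T, ‖g' n i s‖ ≤ (max (A n) 0 * ∑ j ∈ Finset.range (n + 3), C j) * (T - t) ^ k := by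
      intro s hs
      have hs' : s ∈ Ioo a T := ⟨lt_of_lt_of_le ht.1 hs.1, hs.2⟩
      have hsum : ∑ j ∈ Finset.range (n + 3), ‖g j i s‖ ≤ (∑ j ∈ Finset.range (n + 3), C j) * (T - t) ^ k := by
        rw [Finset.sum_mul]
        refine Finset.sum_le_sum fun j _ => (hC j i s hs').trans ?_
        exact mul_le_mul_of_nonneg_left (pow_le_pow_left₀ (by linarith [hs.2]) (by linarith [hs.1]) k) (hC0 j)
      calc ‖g' n i s‖ ≤ A n * ∑ j ∈ Finset.range (n + 3), ‖g j i s‖ := hstruct n i s hs'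
        _ ≤ max (A n) 0 * ∑ j ∈ Finset.range (n + 3), ‖g j i s‖ :=
            mul_le_mul_of_nonneg_right (le_max_left _ _) (Finset.sum_nonneg fun _ _ => norm_nonneg _)
        _ ≤ max (A n) 0 * ((∑ j ∈ Finset.range (n + 3), C j) * (T - t) ^ k) :=
            mul_le_mul_of_nonneg_left hsum (le_max_right _ _)
        _ = (max (A n) 0 * ∑ j ∈ Finset.range (n + 3), C j) * (T - t) ^ k := by ring
    have := norm_le_mul_of_deriv_le_of_tendsto_zero ht.1 ht.2 (hderiv n i) hB (hlim n i)
    calc ‖g n i t‖ ≤ (max (A n) 0 * ∑ j ∈ Finset.range (n + 3), C j) * (T - t) ^ k * (T - t) := this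
      _ = (max (A n) 0 * ∑ j ∈ Finset.range (n + 3), C j) * (T - t) ^ (k + 1) := by ring

/-- **Brick B3 (Navier–Stokes form): the vorticity is flat at the terminal time where its terminal limit vanishes.**
For a classical solution on `[0, T) × ℝ³`, a backward cylinder `(T − R², T) × B_R(x₁)` (`R² < T`) carrying bounds on
every spatial derivative of `u` (brick B1), and a set `s ⊆ B_R(x₁)` at whose points every spatial derivative of
`curl u(t)` tends to `0` as `t → T⁻`: for every `k`, `‖Dⁿₓ curl u(t, x)‖ ≤ C_n (T − t)^k` on `s × (T − R², T)`, with
`C_n ≥ 0` independent of the point. [cite: SereginSverak2009, §2] -/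
theorem vorticity_flat_of_tendsto_zero {ν T R : ℝ} (hRT : R ^ 2 < T)
    {u : ℝ → EuclideanSpace ℝ (Fin 3) → EuclideanSpace ℝ (Fin 3)} {p : ℝ → EuclideanSpace ℝ (Fin 3) → ℝ}
    (hsol : IsClassicalNSSolutionOn (Ico 0 T) ν 0 u p) {x₁ : EuclideanSpace ℝ (Fin 3)}
    {s : Set (EuclideanSpace ℝ (Fin 3))} (hs : s ⊆ ball x₁ R)
    (hK : ∀ n : ℕ, ∃ K : ℝ, ∀ t ∈ Ioo (T - R ^ 2) T, ∀ x ∈ ball x₁ R, ‖iteratedFDeriv ℝ n (u t) x‖ ≤ K)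
    (hlim : ∀ n : ℕ, ∀ x ∈ s, Tendsto (fun t => iteratedFDeriv ℝ n (curl (u t)) x) (𝓝[<] T) (𝓝 0)) :
    ∀ k : ℕ, ∃ C : ℕ → ℝ, (∀ n, 0 ≤ C n) ∧
      ∀ n : ℕ, ∀ x ∈ s, ∀ t ∈ Ioo (T - R ^ 2) T, ‖iteratedFDeriv ℝ n (curl (u t)) x‖ ≤ C n * (T - t) ^ k := by
  choose Kf hKf using hK
  set K : ℕ → ℝ := fun n => max (Kf n) 0 with hK_def
  have hK0 : ∀ n, 0 ≤ K n := fun n => le_max_right _ _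
  have hKb : ∀ n, ∀ t ∈ Ioo (T - R ^ 2) T, ∀ x ∈ ball x₁ R, ‖iteratedFDeriv ℝ n (u t) x‖ ≤ K n :=
    fun n t ht x hx => (hKf n t ht x hx).trans (le_max_left _ _)
  -- the open time window `(0, T)`
  have hS' : Ioo (T - R ^ 2) T ⊆ Ioo 0 T := fun t ht => ⟨by nlinarith [ht.1, sq_nonneg R], ht.2⟩
  have hsol' : IsClassicalNSSolutionOn (Ioo 0 T) ν 0 u p := hsol.mono Ioo_subset_Ico_self (uniqueDiffOn_Ioo 0 T)
  have hω : IsSmoothSpaceTimeOn (Ioo 0 T) (vorticity u) := hsol'.isSmoothSpaceTimeOn_vorticity (uniqueDiffOn_Ioo 0 T)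
  have hcl : Ioo (0 : ℝ) T ⊆ closure (interior (Ioo 0 T)) := by
    rw [isOpen_Ioo.interior_eq]; exact subset_closure
  have hcurl0 : ∀ t ∈ Ioo (0 : ℝ) T, ∀ x : EuclideanSpace ℝ (Fin 3),
      curl ((0 : ℝ → EuclideanSpace ℝ (Fin 3) → EuclideanSpace ℝ (Fin 3)) t) x = 0 := by
    intro t _ x
    rw [curl_eq_curlCLM]
    simp
  -- the differentiated vorticity equation: `∂ₜω = νΔω − (u·∇)ω + (ω·∇)u` as slice functions
  have heq : ∀ t ∈ Ioo (0 : ℝ) T, (fun y => deriv (fun τ => vorticity u τ y) t) =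
      fun y => ν • (Δ (vorticity u t)) y - convect (u t) (vorticity u t) y + convect (vorticity u t) (u t) y := by
    intro t ht
    funext y
    have hv := hsol'.vorticity_eq (uniqueDiffOn_Ioo 0 T) hcl hcurl0 ht y
    rw [timeDerivWithin_apply, derivWithin_of_isOpen isOpen_Ioo ht] at hv
    rw [eq_sub_of_add_eq hv]
    abel
  -- the abstract induction
  set A : ℕ → ℝ := fun n => 3 * |ν| + ∑ i ∈ Finset.range (n + 1), (n.choose i : ℝ) * (K (n - i) + K (i + 1))
    with hA_def
  set Cc : ℝ := ‖(curlCLM : ((EuclideanSpace ℝ (Fin 3)) →L[ℝ] (EuclideanSpace ℝ (Fin 3))) →L[ℝ]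
      (EuclideanSpace ℝ (Fin 3)))‖ with hCc
  have main := norm_le_mul_pow_of_deriv_le_sum_dep (ι := s) (a := T - R ^ 2) (T := T)
    (F := fun n => (EuclideanSpace ℝ (Fin 3)) [×n]→L[ℝ] (EuclideanSpace ℝ (Fin 3)))
    (fun n (i : s) t => iteratedFDeriv ℝ n (vorticity u t) (i : EuclideanSpace ℝ (Fin 3)))
    (fun n (i : s) t => iteratedFDeriv ℝ n (fun y => deriv (fun τ => vorticity u τ y) t) (i : EuclideanSpace ℝ (Fin 3)))
    A (fun n => Cc * K (n + 1)) ?_ ?_ ?_ ?_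
  · intro k
    obtain ⟨C, hC0, hC⟩ := main k
    exact ⟨C, hC0, fun n x hx t ht => hC n ⟨x, hx⟩ t ht⟩
  · -- `∂ₜDⁿω = Dⁿ∂ₜω`
    intro n i t ht
    exact hω.hasDerivAt_iteratedFDeriv_slice isOpen_Ioo n (hS' ht) (i : EuclideanSpace ℝ (Fin 3))
  · -- `‖Dⁿω‖ ≤ ‖curl‖ K_{n+1}`
    intro n i t ht
    have hu : ContDiff ℝ (n + 1) (u t) := (hsol'.contDiff_velocity (hS' ht)).of_le (by exact_mod_cast le_top)
    calc ‖iteratedFDeriv ℝ n (vorticity u t) (i : EuclideanSpace ℝ (Fin 3))‖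
        = ‖iteratedFDeriv ℝ n (curl (u t)) (i : EuclideanSpace ℝ (Fin 3))‖ := rfl
      _ ≤ Cc * ‖iteratedFDeriv ℝ (n + 1) (u t) (i : EuclideanSpace ℝ (Fin 3))‖ := norm_iteratedFDeriv_curl_le hu _
      _ ≤ Cc * K (n + 1) := by
          have hCc0 : 0 ≤ Cc := by rw [hCc]; positivity
          exact mul_le_mul_of_nonneg_left (hKb (n + 1) t ht i (hs i.2)) hCc0
  · -- the structure bound from the vorticity equation
    intro n i t ht
    rw [heq t (hS' ht)]
    exact norm_iteratedFDeriv_vorticityRHS_le (hsol'.contDiff_velocity (hS' ht)) (hω.contDiff_slice (hS' ht))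
      ν n K hK0 (i : EuclideanSpace ℝ (Fin 3)) (fun j _ => hKb j t ht i (hs i.2))
  · -- terminal limits vanish on `s`
    intro n i
    exact hlim n i i.2

end Summit.NavierStokesRegularity.NavierStokesRegularity.Theorems
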